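import Mathlib
import HarnessLib
import Summits.HubbardSuperconductivity.HubbardSuperconductivity.Theorems.KLProgrammeC4aChordMidpointDepthPerturbative

/-!
# Route `KLProgramme` — crux C4a, (U1) «(T)-MARGIN-PERTURBATIVE» part 2: the TANGENCY MARGIN IS THRESHOLD-SMALL under the flat door `A ≤ 1/200`, and the
# DIRECT-SHEET EXCLUSION row of the (U1) arc theorems from EITHER margin

Cell `gate-hubbard-kl`, seat hubbard-kl-k3c3-p3 (g35; row «implicit-function / monotonicity route for μ(n)»).  Helper for stub (C) `stub_twoLeg_curvature` of
`KLRegimeEngineV17F2` (stmt-HubbardSuperconductivity-20437), the (C)-closer lane's (U1) assembly; pen (R383) «(T)-MARGIN-A» (memo HOME/hubbard-kl-k3c3-p3/U1-CAUSTIC-SUP.md §18).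

CONTENT (Sizes binder shape of `…C4aChordMidpointDepth` §4):
* `perturbativeModulus_ge`: `0 ≤ A ≤ 1/200`, `1/10 ≤ m` ⟹ `1/1000 ≤ m/(6π²) − A/8 − A²/(4m)` (`π < 3.1416`);
* **`norm_chord_sq_le_of_midpoint_near_perturbative`**: `A ≤ 1/200`, `‖S − 2Φ(0,χ)‖ ≤ ε` ⟹ `‖Φ(0,θ) − Φ(ρ,ϑ+θ)‖² ≤ 10³·(|ρ|/2 + 5ρ²/2 + K_c·ε/2)` — part 1's
  perturbative depth (`c = −μ − A − |ρ| > 1/10` by `hhi`) against the `K_c`-Lipschitz lower bound `−K_cε/2 ≤ e_K(S/2)`; NO `A` in the bound, so the tangency margin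
  of the (U1) arc theorems is `ϑ_T² ≈ 10³(ρ_C/2 + K_cτ₀/2)(π/(2u_min))²`, THRESHOLD-SMALL (the parent's additive-slack bound gives `≈ 3·10³·A/u_min²`);
* **`directSheet_excluded_of_margin`** (parent margin `6π²(2A + |ρ| + K_cτ₀/2)/(−μ−A−|ρ|) < ((2u_min/π)ϑ_T)²`, no extra door) and
  **`directSheet_excluded_of_margin_perturbative`** (margin `10³(|ρ|/2 + 5ρ²/2 + K_cτ₀/2) < ((2u_min/π)ϑ_T)²`, door `A ≤ 1/200`): for every relative angle with
  `ϑ_T ≤ ‖ϑ‖_𝕋` and every loop angle `χ`, `τ₀ < ‖S_{ρ,ϑ,θ} − 2Φ(0,χ)‖` — the primitive row `hT0` («no direct-sheet caustic at scale `τ₀`») of the margin-free (U1)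
  arc theorems, so the (C) closer picks the margin per call.
Elementary; nothing asserts (C), K3, the window or superconductivity.
References: FST II CPAM 51 (1998) §3 (H3) [cite: FeldmanSalmhoferTrubowitz1998]; BGM 2003 §7.1 [cite: BenfattoGiulianiMastropietro2003];
BGM 2006 §2.4 [cite: BenfattoGiulianiMastropietro2006].
-/

noncomputable section

namespace Summit.HubbardSuperconductivity.HubbardSuperconductivity.Theorems.C4a

set_option linter.dupNamespace false -- summit = problem name (single-conjunct summit), D-0017

open Real Set
open Literature.MathematicalPhysics.QuantumLattice Literature.MathematicalPhysics.QuantumLattice.BandSectorCounting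
open Literature.MathematicalPhysics.QuantumLattice.FermiRG
open Summit.HubbardSuperconductivity.HubbardSuperconductivity.Theorems.KLRegimeSplit
open Summit.HubbardSuperconductivity.HubbardSuperconductivity.Theorems.DispersionFlow
open Summit.HubbardSuperconductivity.HubbardSuperconductivity.Theorems.PerturbedFermiCurve

/-! ## §1 The modulus under the flat door `A ≤ 1/200` -/

/-- **The perturbative modulus is at least `1/1000` under the flat door**: `0 ≤ A ≤ 1/200`, `1/10 ≤ m` ⟹ `1/1000 ≤ m/(6π²) − A/8 − A²/(4m)` (`π < 3.1416`). -/
theorem perturbativeModulus_ge {A m : ℝ} (hA0 : 0 ≤ A) (hA200 : A ≤ 1 / 200) (hm : 1 / 10 ≤ m) :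
    1 / 1000 ≤ m / (6 * π ^ 2) - A / 8 - A ^ 2 / (4 * m) := by
  have hπ := Real.pi_lt_d4
  have hπ0 := Real.pi_pos
  have hsq : π ^ 2 < 3.1416 ^ 2 := pow_lt_pow_left₀ hπ hπ0.le two_ne_zero
  have hπsq : 6 * π ^ 2 < 2961 / 50 := by norm_num at hsq ⊢; linarith
  have hm0 : 0 < m := by linarith
  have h1 : m / (2961 / 50) ≤ m / (6 * π ^ 2) := div_le_div_of_nonneg_left hm0.le (by positivity) hπsq.le
  have h2 : A ^ 2 ≤ 1 / 40000 := by nlinarith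
  have h3 : A ^ 2 / (4 * m) ≤ 1 / 16000 := by rw [div_le_iff₀ (by positivity)]; linarith
  have h4 : (1 / 10 : ℝ) / (2961 / 50) ≤ m / (2961 / 50) := div_le_div_of_nonneg_right hm (by norm_num)
  have h5 : (1 : ℝ) / 1000 + 1 / 1600 + 1 / 16000 ≤ (1 / 10 : ℝ) / (2961 / 50) := by norm_num
  linarith

/-! ## §2 Short chord from a near-curve midpoint; the direct-sheet exclusion from either margin -/

section Sizes

variable {K : TrigPolyC4v} {A : ℝ} (hA : ∀ p : Momentum, ∀ j ≤ 2, ‖iteratedFDeriv ℝ j (frameShift K) p‖ ≤ A)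
  {μ r : ℝ} (hr : 0 < r) (hlo : (-1.1 : ℝ) < μ - r - A) (hhi : μ + r + A < -0.1)
include hA hr hlo hhi

/-- **Short chord from a near-curve midpoint, PERTURBATIVE form** (flat door `A ≤ 1/200`): if `‖S − 2Φ(0,χ)‖ ≤ ε` (`S = Φ(0,θ) + Φ(ρ,ϑ+θ)`, `|ρ| < r`) then,
`e_K` being `Kc`-Lipschitz under `GeomConstants (frameLevel μ K) Kc r₀ g₀ w`, `‖Φ(0,θ) − Φ(ρ,ϑ+θ)‖² ≤ 10³·(|ρ|/2 + 5ρ²/2 + Kc·ε/2)` — threshold-small, no `A`.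
[cite: FeldmanSalmhoferTrubowitz1998, §3 (H3)] -/
theorem norm_chord_sq_le_of_midpoint_near_perturbative (hA200 : A ≤ 1 / 200) {Kc r₀ g₀ w : ℝ} (hG : GeomConstants (frameLevel μ K) Kc r₀ g₀ w)
    {ρ : ℝ} (hρ : |ρ| < r) {ϑ θ χ ε : ℝ} (hε : ‖pairSumPath μ K ρ ϑ θ 0 - (2 : ℝ) • levelPoint μ K 0 χ‖ ≤ ε) :
    ‖levelPoint μ K 0 θ - levelPoint μ K ρ (ϑ + θ)‖ ^ 2 ≤ 1000 * (|ρ| / 2 + 5 / 2 * ρ ^ 2 + Kc * ε / 2) := by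
  set B := bandBounds (show (-4 : ℝ) < -1.1 by norm_num) (show (-1.1 : ℝ) ≤ -0.1 by norm_num) (show (-0.1 : ℝ) < 0 by norm_num) with hBdef
  have hρ1 := (abs_lt.1 hρ).1; have hρ2 := (abs_lt.1 hρ).2
  have hρabs : |ρ| < r := hρ
  have hA0 : 0 ≤ A := le_trans (norm_nonneg _) (hA 0 0 (by norm_num))
  have hlo₀ : (-1.1 : ℝ) ≤ μ + 0 - A := by linarith
  have hhi₀ : μ + 0 + A ≤ -0.1 := by linarith
  have hloρ : (-1.1 : ℝ) ≤ μ + ρ - A := by linarith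
  have hhiρ : μ + ρ + A ≤ -0.1 := by linarith
  have hneg : μ + A + |ρ| < 0 := by linarith
  set m := -μ - A - |ρ| with hmdef
  have hm10 : 1 / 10 ≤ m := by rw [hmdef]; linarith
  have hm0 : 0 < m := by linarith
  have hdepth := frameLevel_midpoint_pairSum_le_perturbative B hA hlo₀ hhi₀ hloρ hhiρ hneg ϑ θ
  rw [← hmdef] at hdepth
  -- Lipschitz from the curve point `Φ(0,χ)` (`e_K = 0` there)
  have hzero : frameLevel μ K (levelPoint μ K 0 χ) = 0 := frameLevel_levelPoint_zero B hA hr hlo hhi χ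
  have hS : pairSumPath μ K ρ ϑ θ 0 = levelPoint μ K 0 θ + levelPoint μ K ρ (ϑ + θ) := by simp only [pairSumPath, add_zero]
  set M : Momentum := (1 / 2 : ℝ) • (levelPoint μ K 0 θ + levelPoint μ K ρ (ϑ + θ)) with hMdef
  have hMQ : ‖M - levelPoint μ K 0 χ‖ ≤ ε / 2 := by
    have e : M - levelPoint μ K 0 χ = (1 / 2 : ℝ) • (pairSumPath μ K ρ ϑ θ 0 - (2 : ℝ) • levelPoint μ K 0 χ) := by
      rw [hMdef, hS]; module
    rw [e, norm_smul, Real.norm_eq_abs, abs_of_pos (by norm_num : (0 : ℝ) < 1 / 2)]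
    linarith
  have hlip := PerturbedFermiCurve.abs_frameLevel_sub_le hG (levelPoint μ K 0 χ) M
  rw [hzero, sub_zero] at hlip
  have hKc : 0 ≤ Kc := le_trans (norm_nonneg _) (hG.norm_iteratedFDeriv_le (0 : Momentum) 0 (by norm_num))
  have hlow : -(Kc * ε / 2) ≤ frameLevel μ K M := by
    have h1 := (abs_le.1 hlip).1
    have h2 : Kc * ‖M - levelPoint μ K 0 χ‖ ≤ Kc * (ε / 2) := mul_le_mul_of_nonneg_left hMQ hKc
    linarith
  -- the modulus and the `ρ²` term
  set L := ‖levelPoint μ K 0 θ - levelPoint μ K ρ (ϑ + θ)‖ ^ 2 with hLdef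
  have hL0 : 0 ≤ L := sq_nonneg _
  have hκ := perturbativeModulus_ge hA0 hA200 hm10
  have hρsq : ρ ^ 2 / (4 * m) ≤ 5 / 2 * ρ ^ 2 := by
    rw [div_le_iff₀ (by positivity)]; nlinarith [sq_nonneg ρ]
  have hkey : (m / (6 * π ^ 2) - A / 8 - A ^ 2 / (4 * m)) * L ≤ |ρ| / 2 + 5 / 2 * ρ ^ 2 + Kc * ε / 2 := by
    have := le_abs_self ρ; linarith
  have hkey' : 1 / 1000 * L ≤ |ρ| / 2 + 5 / 2 * ρ ^ 2 + Kc * ε / 2 := (mul_le_mul_of_nonneg_right hκ hL0).trans hkey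
  linarith

/-- **NO DIRECT-SHEET CAUSTIC OFF THE TANGENCY MARGIN — from the ADDITIVE-SLACK margin** (parent §3/§4; no extra door): if
`6π²(2A + |ρ| + K_cτ₀/2)/(−μ−A−|ρ|) < ((2u_min/π)ϑ_T)²` (`0 ≤ ϑ_T`), then for every relative angle with `ϑ_T ≤ ‖ϑ‖_𝕋` and every loop angle `χ`,
`τ₀ < ‖S_{ρ,ϑ,θ} − 2Φ(0,χ)‖` — the primitive row `hT0` of the margin-free (U1) arc theorems. -/
theorem directSheet_excluded_of_margin {Kc r₀ g₀ w : ℝ} (hG : GeomConstants (frameLevel μ K) Kc r₀ g₀ w) {ρ : ℝ} (hρ : |ρ| < r) (θ : ℝ)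
    {τ₀ ϑT : ℝ} (hϑT0 : 0 ≤ ϑT)
    (hϑT : 6 * π ^ 2 * (2 * A + |ρ| + Kc * τ₀ / 2) / (-μ - A - |ρ|) <
      (2 * (bandBounds (show (-4 : ℝ) < -1.1 by norm_num) (show (-1.1 : ℝ) ≤ -0.1 by norm_num) (show (-0.1 : ℝ) < 0 by norm_num)).umin / π * ϑT) ^ 2) :
    ∀ ϑ : ℝ, ϑT ≤ torusDist ϑ → ∀ χ : ℝ, τ₀ < ‖pairSumPath μ K ρ ϑ θ 0 - (2 : ℝ) • levelPoint μ K 0 χ‖ := by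
  intro ϑ hϑ χ
  by_contra hle
  push Not at hle
  have hupos : 0 < 2 * (bandBounds (show (-4 : ℝ) < -1.1 by norm_num) (show (-1.1 : ℝ) ≤ -0.1 by norm_num) (show (-0.1 : ℝ) < 0 by norm_num)).umin / π := by
    have := (bandBounds (show (-4 : ℝ) < -1.1 by norm_num) (show (-1.1 : ℝ) ≤ -0.1 by norm_num) (show (-0.1 : ℝ) < 0 by norm_num)).umin_pos
    positivity
  have h1 := norm_chord_sq_le_of_midpoint_near hA hr hlo hhi hG hρ hle
  have h2 := torusDist_le_norm_chord hA hlo hhi hρ ϑ θ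
  have h3 : (2 * (bandBounds (show (-4 : ℝ) < -1.1 by norm_num) (show (-1.1 : ℝ) ≤ -0.1 by norm_num) (show (-0.1 : ℝ) < 0 by norm_num)).umin / π *
      torusDist ϑ) ^ 2 ≤ ‖levelPoint μ K 0 θ - levelPoint μ K ρ (ϑ + θ)‖ ^ 2 :=
    pow_le_pow_left₀ (mul_nonneg hupos.le (norm_nonneg _)) h2 2
  have h4 : (2 * (bandBounds (show (-4 : ℝ) < -1.1 by norm_num) (show (-1.1 : ℝ) ≤ -0.1 by norm_num) (show (-0.1 : ℝ) < 0 by norm_num)).umin / π * ϑT) ^ 2 ≤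
      (2 * (bandBounds (show (-4 : ℝ) < -1.1 by norm_num) (show (-1.1 : ℝ) ≤ -0.1 by norm_num) (show (-0.1 : ℝ) < 0 by norm_num)).umin / π *
        torusDist ϑ) ^ 2 :=
    pow_le_pow_left₀ (mul_nonneg hupos.le hϑT0) (mul_le_mul_of_nonneg_left hϑ hupos.le) 2
  linarith

/-- **NO DIRECT-SHEET CAUSTIC OFF THE TANGENCY MARGIN — from the PERTURBATIVE margin** (flat door `A ≤ 1/200`): if
`10³(|ρ|/2 + 5ρ²/2 + K_cτ₀/2) < ((2u_min/π)ϑ_T)²` (`0 ≤ ϑ_T`; THRESHOLD-SMALL in `ρ`, `τ₀`), then for every relative angle with `ϑ_T ≤ ‖ϑ‖_𝕋` and every loop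
angle `χ`, `τ₀ < ‖S_{ρ,ϑ,θ} − 2Φ(0,χ)‖`. -/
theorem directSheet_excluded_of_margin_perturbative (hA200 : A ≤ 1 / 200) {Kc r₀ g₀ w : ℝ} (hG : GeomConstants (frameLevel μ K) Kc r₀ g₀ w)
    {ρ : ℝ} (hρ : |ρ| < r) (θ : ℝ) {τ₀ ϑT : ℝ} (hϑT0 : 0 ≤ ϑT)
    (hϑT : 1000 * (|ρ| / 2 + 5 / 2 * ρ ^ 2 + Kc * τ₀ / 2) <
      (2 * (bandBounds (show (-4 : ℝ) < -1.1 by norm_num) (show (-1.1 : ℝ) ≤ -0.1 by norm_num) (show (-0.1 : ℝ) < 0 by norm_num)).umin / π * ϑT) ^ 2) :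
    ∀ ϑ : ℝ, ϑT ≤ torusDist ϑ → ∀ χ : ℝ, τ₀ < ‖pairSumPath μ K ρ ϑ θ 0 - (2 : ℝ) • levelPoint μ K 0 χ‖ := by
  intro ϑ hϑ χ
  by_contra hle
  push Not at hle
  have hupos : 0 < 2 * (bandBounds (show (-4 : ℝ) < -1.1 by norm_num) (show (-1.1 : ℝ) ≤ -0.1 by norm_num) (show (-0.1 : ℝ) < 0 by norm_num)).umin / π := by
    have := (bandBounds (show (-4 : ℝ) < -1.1 by norm_num) (show (-1.1 : ℝ) ≤ -0.1 by norm_num) (show (-0.1 : ℝ) < 0 by norm_num)).umin_pos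
    positivity
  have h1 := norm_chord_sq_le_of_midpoint_near_perturbative hA hr hlo hhi hA200 hG hρ hle
  have h2 := torusDist_le_norm_chord hA hlo hhi hρ ϑ θ
  have h3 : (2 * (bandBounds (show (-4 : ℝ) < -1.1 by norm_num) (show (-1.1 : ℝ) ≤ -0.1 by norm_num) (show (-0.1 : ℝ) < 0 by norm_num)).umin / π *
      torusDist ϑ) ^ 2 ≤ ‖levelPoint μ K 0 θ - levelPoint μ K ρ (ϑ + θ)‖ ^ 2 :=
    pow_le_pow_left₀ (mul_nonneg hupos.le (norm_nonneg _)) h2 2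
  have h4 : (2 * (bandBounds (show (-4 : ℝ) < -1.1 by norm_num) (show (-1.1 : ℝ) ≤ -0.1 by norm_num) (show (-0.1 : ℝ) < 0 by norm_num)).umin / π * ϑT) ^ 2 ≤
      (2 * (bandBounds (show (-4 : ℝ) < -1.1 by norm_num) (show (-1.1 : ℝ) ≤ -0.1 by norm_num) (show (-0.1 : ℝ) < 0 by norm_num)).umin / π *
        torusDist ϑ) ^ 2 :=
    pow_le_pow_left₀ (mul_nonneg hupos.le hϑT0) (mul_le_mul_of_nonneg_left hϑ hupos.le) 2
  linarith

end Sizes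

end Summit.HubbardSuperconductivity.HubbardSuperconductivity.Theorems.C4a

end
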